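import Literature.Computability.MetaComplexity.TseitinDepthFregeTransfer
import HarnessLib

/-!
# Bounded-depth `textbookFrege`: accumulating local semantic consequences in a conjunction

Support layer for the bounded-depth Frege upper bound through Gaussian width
(`GaussianWidthDepthFregeUpperBound.lean`), in the bounded-derivation calculus `TextbookFrege.BD`
of `FregeBounded.lean` (one-sided sequents `⊢ A₁, …, A_k` read as `disjList`). A DAG-like
derivation whose every line follows SEMANTICALLY from at most two earlier lines over few
variables (a Gaussian refutation, line = parity of `≤ w` variables) is simulated without
re-deriving shared lines by carrying ONE line `⊢ ⋀M, Φ` — the conjunction `⋀M = conjList M` of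
everything derived so far, in the context `Φ` (the negated hypothesis) — and using it exactly
once per step, so that line counts add instead of multiply:

* `tautSeqW` — the truth-table lemma `tautSeqS` (GIRS Lemma 4) with separate budgets for the
  number `N` of variables (cost `2^N`) and the number `G` of sequent members (polynomial cost);
* `localStepS` — from `A₁, A₂ ∈ M` and a formula `C` implied by `A₁ ∧ A₂`, the three mentioning
  `≤ N` variables: `⊢ C ∧ ⋀M, ¬⋀M` (two conjunct extractions, one truth table, two cuts, one
  `∧`-introduction against the axiom `⊢ ⋀M, ¬⋀M`);
* `chainStepS` — one cut of the carried line `⊢ ⋀M, Φ` against it gives `⊢ ⋀(C :: M), Φ`;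
* `chainFinalS` — once `⊥ ∈ M`, the carried line yields `Φ` itself.

Line counts are explicit polynomials (`stepLines`); disjunct depths are fixed numerically
(members of `M` of disjunct depth `≤ 3`, as DNFs are; `Φ` of disjunct depth `≤ 6`; `D ≥ 16`).
All statements are proved; the bookkeeping is folklore (Shoenfield 1967, §3.1).

References: N. Galesi, D. Itsykson, A. Riazanov, A. Sofronova, *Bounded-depth Frege complexity of
Tseitin formulas for all graphs*, APAL 174 (2023), Lemma 4 and §4; J. R. Shoenfield,
*Mathematical Logic* (1967), §3.1.
-/

namespace Literature.Computability.MetaComplexity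

open Complexity Complexity.PropForm

namespace TextbookFrege

variable {D B : ℕ}

/-! ### Truth tables with many sequent members -/

/-- **A tautological sequent over few variables has a short bounded derivation**, with separate
budgets: `N` bounds the number of variables (`2^N` cases) and `G` the number of members of `Γ`
(entering only polynomially). Otherwise as `tautSeqS`. [cite: GalesiEtAl2023, Lemma 4] -/
theorem tautSeqW (Γ : List (PropForm ℕ)) (V : List ℕ) (hV : V.Nodup) {N G q S₀ : ℕ}
    (hN : V.length ≤ N) (hΓG : Γ.length ≤ G) (hvars : ∀ A ∈ Γ, ∀ x ∈ A.vars, x ∈ V)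
    (htaut : ∀ τ : ℕ → Bool, ∃ A ∈ Γ, A.eval τ = true) (hq : ∀ A ∈ Γ, A.altDepth ≤ q)
    (hS : msum Γ ≤ S₀) (hD : q + 8 ≤ D) (hB : 40 * (S₀ + N) + 200 ≤ B) :
    BD D B (2 ^ N * (S₀ * (100 * (N + 8) ^ 2) + 50 * (N + G + 3) ^ 2 + 2)) (disjList Γ) := by
  have hsize : ∀ A ∈ Γ, A.size ≤ S₀ := fun A hA => (size_lt_msum hA).le.trans hS
  have hcase : ∀ τ : ℕ → Bool,
      BD D B (S₀ * (100 * (N + 8) ^ 2) + 50 * (N + G + 3) ^ 2) (disjList (assump τ V ++ Γ)) := by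
    intro τ
    obtain ⟨A, hA, hAτ⟩ := htaut τ
    have h1 := evalS τ V hN hD hB A (hsize A hA) (hq A hA) (hvars A hA)
    have hsg : signed τ A = A := by simp [signed, hAτ]
    rw [hsg] at h1
    have hmsV := msum_assump_le τ V
    refine (subsetN (N := N + G + 2) (L' := assump τ V ++ Γ) h1 ?_ (p := q + 1) ?_ (by omega) ?_
      (by simp; omega) (by simp; omega)).mono ?_
    · intro X hX
      rcases List.mem_cons.1 hX with rfl | hX
      · exact List.mem_append_right _ hA
      · exact List.mem_append_left _ hX
    · intro X hX
      rcases List.mem_append.1 hX with hX | hX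
      · exact (dd_le_of_mem_assump hX).trans (by omega)
      · exact (dd_le_altDepth X).trans ((hq X hX).trans (by omega))
    · rw [size_disjList_eq_msum, size_disjList_eq_msum, msum_cons, msum_append]
      have := hsize A hA
      omega
    · have : A.size * (100 * (N + 8) ^ 2) ≤ S₀ * (100 * (N + 8) ^ 2) :=
        Nat.mul_le_mul_right _ (hsize A hA)
      have e : N + G + 2 + 1 = N + G + 3 := by omega
      rw [e]; omega
  have hsplit := splitS Γ V hV (by omega) hcase
  refine hsplit.mono ?_
  exact Nat.mul_le_mul_right _ (Nat.pow_le_pow_right (by norm_num) hN)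

/-! ### Size bookkeeping for the carried conjunction -/

variable {ℓ ℓ₀ ℓ₁ ℓ₂ ℓ₃ P Q N : ℕ} {M : List (PropForm ℕ)} {A A₁ A₂ C Φ : PropForm ℕ}

/-- The size of a list conjunction with `≤ Q` members of size `≤ P`. [folklore] -/
theorem size_conjList_le (hP : ∀ X ∈ M, X.size ≤ P) (hQ : M.length ≤ Q) :
    (conjList M).size ≤ Q * (P + 1) + 1 := by
  rw [size_conjList_eq_msum]
  have h := msum_le_length_mul (L := M) (W := P + 1) fun X hX => Nat.succ_le_succ (hP X hX)
  have : M.length * (P + 1) ≤ Q * (P + 1) := Nat.mul_le_mul_right _ hQ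
  omega

/-- Disjunct depth of a list conjunction of members of disjunct depth `≤ 3`. [folklore] -/
theorem dd_conjList_le_five (hM : ∀ X ∈ M, X.dd ≤ 3) : (conjList M).dd ≤ 5 :=
  dd_conjList_le hM

/-- Disjunct depth of a negated list conjunction of members of disjunct depth `≤ 3`. [folklore] -/
theorem dd_neg_conjList_le_six (hM : ∀ X ∈ M, X.dd ≤ 3) : (neg (conjList M)).dd ≤ 6 :=
  dd_neg_conjList_le hM

/-- The line count of one local step (`localStepS` followed by `chainStepS`). [folklore] -/
def stepLines (P Q N : ℕ) : ℕ :=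
  2 ^ N * ((3 * P + 5) * (100 * (N + 8) ^ 2) + 50 * (N + 6) ^ 2 + 2) + 252 * Q + 8000

/-- `stepLines` is monotone in the length budget. [folklore] -/
theorem stepLines_mono_Q {Q Q' : ℕ} (h : Q ≤ Q') : stepLines P Q N ≤ stepLines P Q' N := by
  unfold stepLines; omega

/-! ### One local step -/

/-- **Local step.** Let `M` be a list of formulas of disjunct depth `≤ 3` and size `≤ P`, of
length `< Q`, and `K = ⋀M`. If `A₁, A₂ ∈ M` and `C` (disjunct depth `≤ 3`, size `≤ P`) is true
whenever `A₁` and `A₂` are, the three formulas mentioning only the `≤ N` variables of the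
duplicate-free list `V`, then `⊢ C ∧ K, ¬K` has a bounded derivation with at most
`stepLines P Q N - 1700` lines: extract `A₁`, `A₂` from `K`, derive the tautological sequent
`⊢ C, ¬A₁, ¬A₂` by a truth table over `V`, cut twice, and introduce the conjunction against the
axiom `⊢ K, ¬K`. [cite: GalesiEtAl2023, Lemma 4 and §4 (local parity steps)] -/
theorem localStepS (V : List ℕ) (hV : V.Nodup) (hVN : V.length ≤ N)
    (hM : ∀ X ∈ M, X.dd ≤ 3) (hP : ∀ X ∈ M, X.size ≤ P) (hQ : M.length + 1 ≤ Q)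
    (hA₁ : A₁ ∈ M) (hA₂ : A₂ ∈ M) (hC : C.dd ≤ 3) (hCP : C.size ≤ P)
    (hvC : ∀ x ∈ C.vars, x ∈ V) (hv₁ : ∀ x ∈ A₁.vars, x ∈ V) (hv₂ : ∀ x ∈ A₂.vars, x ∈ V)
    (himp : ∀ τ : ℕ → Bool, A₁.eval τ = true → A₂.eval τ = true → C.eval τ = true)
    (hD : 16 ≤ D) (hB : 128 * (Q * (P + 1) + 1) + 40 * N + 600 ≤ B) :
    BD D B (stepLines P Q N - 1700) (disjList [conj C (conjList M), neg (conjList M)]) := by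
  have hKsize : (conjList M).size ≤ Q * (P + 1) + 1 := size_conjList_le hP (by omega)
  have hKdd : (conjList M).dd ≤ 5 := dd_conjList_le_five hM
  have hnKdd : (neg (conjList M)).dd ≤ 6 := dd_neg_conjList_le_six hM
  have hP₁ : A₁.size ≤ P := hP A₁ hA₁
  have hP₂ : A₂.size ≤ P := hP A₂ hA₂
  have hd₁ : A₁.dd ≤ 3 := hM A₁ hA₁
  have hd₂ : A₂.dd ≤ 3 := hM A₂ hA₂
  have hnd₁ : (neg A₁).dd ≤ 5 := by rw [dd_neg]; have := altDepthAux_le_dd_succ 1 A₁; omega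
  have hnd₂ : (neg A₂).dd ≤ 5 := by rw [dd_neg]; have := altDepthAux_le_dd_succ 1 A₂; omega
  have hPK : P ≤ Q * (P + 1) := by
    have : 1 ≤ Q := by omega
    calc P ≤ 1 * (P + 1) := by omega
      _ ≤ Q * (P + 1) := Nat.mul_le_mul_right _ this
  -- (1) conjunct extractions `⊢ ¬K, Aᵢ`
  have hlenQ : M.length ≤ Q := by omega
  have e₁ : BD D B (12 + 126 * Q) (disjList [neg (conjList M), A₁]) :=
    (conjExtractS hA₁ hM (by omega) (by omega)).mono (by nlinarith)
  have e₂ : BD D B (12 + 126 * Q) (disjList [neg (conjList M), A₂]) :=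
    (conjExtractS hA₂ hM (by omega) (by omega)).mono (by nlinarith)
  -- (2) the truth table `⊢ C, ¬A₁, ¬A₂`
  have htaut : ∀ τ : ℕ → Bool, ∃ X ∈ [C, neg A₁, neg A₂], X.eval τ = true := by
    intro τ
    by_cases h₁ : A₁.eval τ = true
    · by_cases h₂ : A₂.eval τ = true
      · exact ⟨C, by simp, himp τ h₁ h₂⟩
      · exact ⟨neg A₂, by simp, by simpa [eval] using h₂⟩
    · exact ⟨neg A₁, by simp, by simpa [eval] using h₁⟩
  have hq : ∀ X ∈ [C, neg A₁, neg A₂], X.altDepth ≤ 6 := by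
    intro X hX
    simp only [List.mem_cons, List.not_mem_nil, or_false] at hX
    rcases hX with rfl | rfl | rfl
    · exact (altDepth_le_dd_succ _).trans (by omega)
    · exact (altDepth_le_dd_succ _).trans (by omega)
    · exact (altDepth_le_dd_succ _).trans (by omega)
  have hvars : ∀ X ∈ [C, neg A₁, neg A₂], ∀ x ∈ X.vars, x ∈ V := by
    intro X hX
    simp only [List.mem_cons, List.not_mem_nil, or_false] at hX
    rcases hX with rfl | rfl | rfl
    · exact hvC
    · exact hv₁
    · exact hv₂
  have t₀ : BD D B (2 ^ N * ((3 * P + 5) * (100 * (N + 8) ^ 2) + 50 * (N + 3 + 3) ^ 2 + 2))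
      (disjList [C, neg A₁, neg A₂]) :=
    tautSeqW [C, neg A₁, neg A₂] V hV hVN (G := 3) (by simp) hvars htaut hq
      (S₀ := 3 * P + 5) (by simp only [msum_cons, msum_nil, size]; omega) (by omega) (by omega)
  -- (3) two cuts in the context `[C, ¬K]`
  have hctx : ∀ X ∈ [neg A₂, neg A₁, C, neg (conjList M)], X.dd ≤ 6 := by
    intro X hX
    simp only [List.mem_cons, List.not_mem_nil, or_false] at hX
    rcases hX with rfl | rfl | rfl | rfl <;> omega
  have t₁ : BD D B (2 ^ N * ((3 * P + 5) * (100 * (N + 8) ^ 2) + 50 * (N + 3 + 3) ^ 2 + 2) +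
      1250) (disjList [neg A₂, neg A₁, C, neg (conjList M)]) :=
    subsetN (N := 4) t₀ (by intro X hX; simp only [List.mem_cons, List.not_mem_nil, or_false] at hX ⊢; tauto)
      hctx (by omega) (by
        simp only [size_disjList_cons, size_disjList_nil, size]; omega) (by simp) (by simp)
  have e₂' : BD D B (12 + 126 * Q + 1250) (disjList [A₂, neg A₁, C, neg (conjList M)]) :=
    subsetN (N := 4) e₂ (by intro X hX; simp only [List.mem_cons, List.not_mem_nil, or_false] at hX ⊢; tauto)
      (p := 6) (by
        intro X hX; simp only [List.mem_cons, List.not_mem_nil, or_false] at hX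
        rcases hX with rfl | rfl | rfl | rfl <;> omega) (by omega) (by
        simp only [size_disjList_cons, size_disjList_nil, size]; omega) (by simp) (by simp)
  have c₁ := cutS e₂' t₁ (by simp only [size_disjList_cons, size_disjList_nil, size]; omega)
  have e₁' : BD D B (12 + 126 * Q + 1250) (disjList [A₁, C, neg (conjList M)]) :=
    subsetN (N := 4) e₁ (by intro X hX; simp only [List.mem_cons, List.not_mem_nil, or_false] at hX ⊢; tauto)
      (p := 6) (by
        intro X hX; simp only [List.mem_cons, List.not_mem_nil, or_false] at hX
        rcases hX with rfl | rfl | rfl <;> omega) (by omega) (by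
        simp only [size_disjList_cons, size_disjList_nil, size]; omega) (by simp) (by simp)
  have c₂ := cutS e₁' c₁ (by simp only [size_disjList_cons, size_disjList_nil, size]; omega)
  -- (4) `∧`-introduction against the axiom `⊢ K, ¬K`
  have ax₀ : BD D B 12 (disjList [neg (conjList M), conjList M]) := axS (conjList M) (by omega) (by omega)
  have ax : BD D B (12 + 450) (disjList [conjList M, neg (conjList M)]) :=
    subsetN (N := 2) ax₀ (by intro X hX; simp only [List.mem_cons, List.not_mem_nil, or_false] at hX ⊢; tauto)
      (p := 6) (by
        intro X hX; simp only [List.mem_cons, List.not_mem_nil, or_false] at hX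
        rcases hX with rfl | rfl <;> omega) (by omega) (by
        simp only [size_disjList_cons, size_disjList_nil, size]; omega) (by simp) (by simp)
  have fin := consConjS c₂ ax (by omega) (by omega) (by
      simp only [disjList_cons, disjList_nil, dd_disj, dd_const]; omega) (by
      simp only [size_disjList_cons, size_disjList_nil, size]; omega)
  refine fin.mono ?_
  have e3 : N + 3 + 3 = N + 6 := by omega
  rw [e3]
  unfold stepLines
  omega

/-! ### The chain -/

/-- **Chain step.** From the carried line `⊢ ⋀M, Φ` and the local step `⊢ C ∧ ⋀M, ¬⋀M`, one cut
gives the new carried line `⊢ ⋀(C :: M), Φ`; the old line is used once, so lines add.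
[Shoenfield 1967, §3.1 (cut)] [folklore] -/
theorem chainStepS (hM : ∀ X ∈ M, X.dd ≤ 3) (hP : ∀ X ∈ M, X.size ≤ P) (hQ : M.length + 1 ≤ Q)
    (hC : C.dd ≤ 3) (hCP : C.size ≤ P) (hΦ : Φ.dd ≤ 6) (hΦB : 8 * Φ.size ≤ B)
    (hJ : BD D B ℓ (disjList [conjList M, Φ]))
    (hstep : BD D B ℓ₁ (disjList [conj C (conjList M), neg (conjList M)]))
    (hD : 16 ≤ D) (hB : 128 * (Q * (P + 1) + 1) + 40 * N + 600 ≤ B) :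
    BD D B (ℓ + ℓ₁ + 1700) (disjList [conjList (C :: M), Φ]) := by
  have hKsize : (conjList M).size ≤ Q * (P + 1) + 1 := size_conjList_le hP (by omega)
  have hKdd : (conjList M).dd ≤ 5 := dd_conjList_le_five hM
  have hnKdd : (neg (conjList M)).dd ≤ 6 := dd_neg_conjList_le_six hM
  have hCKdd : (conj C (conjList M)).dd ≤ 5 :=
    dd_conjList_le_five (M := C :: M) (by
      intro X hX; rcases List.mem_cons.1 hX with rfl | hX; exacts [hC, hM X hX])
  have hPK : P ≤ Q * (P + 1) := by
    have : 1 ≤ Q := by omega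
    calc P ≤ 1 * (P + 1) := by omega
      _ ≤ Q * (P + 1) := Nat.mul_le_mul_right _ this
  have hctx : ∀ X ∈ [neg (conjList M), conj C (conjList M), Φ], X.dd ≤ 6 := by
    intro X hX
    simp only [List.mem_cons, List.not_mem_nil, or_false] at hX
    rcases hX with rfl | rfl | rfl <;> omega
  have J' : BD D B (ℓ + 800) (disjList [conjList M, conj C (conjList M), Φ]) :=
    subsetN (N := 3) hJ (by intro X hX; simp only [List.mem_cons, List.not_mem_nil, or_false] at hX ⊢; tauto)
      (p := 6) (by
        intro X hX; simp only [List.mem_cons, List.not_mem_nil, or_false] at hX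
        rcases hX with rfl | rfl | rfl <;> omega) (by omega) (by
        simp only [size_disjList_cons, size_disjList_nil, size]; omega) (by simp) (by simp)
  have s' : BD D B (ℓ₁ + 800) (disjList [neg (conjList M), conj C (conjList M), Φ]) :=
    subsetN (N := 3) hstep (by intro X hX; simp only [List.mem_cons, List.not_mem_nil, or_false] at hX ⊢; tauto)
      hctx (by omega) (by
        simp only [size_disjList_cons, size_disjList_nil, size]; omega) (by simp) (by simp)
  have c := cutS J' s' (by simp only [size_disjList_cons, size_disjList_nil, size]; omega)
  have c' : BD D B (ℓ + 800 + (ℓ₁ + 800) + 2) (disjList [conjList (C :: M), Φ]) := c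
  have hle : ℓ + 800 + (ℓ₁ + 800) + 2 ≤ ℓ + ℓ₁ + 1700 := by
    clear c' c s' J' hctx hPK hCKdd hnKdd hKdd hKsize hB hD hstep hJ hΦB hΦ hCP hC hQ hP hM
    omega
  exact c'.mono hle

/-- **One full step of the chain**: `⊢ ⋀M, Φ` with `ℓ` lines gives `⊢ ⋀(C :: M), Φ` with
`ℓ + stepLines P Q N` lines, for a local semantic consequence `C` of two members of `M`.
[cite: GalesiEtAl2023, §4 (local parity steps)] -/
theorem chainLocalS (V : List ℕ) (hV : V.Nodup) (hVN : V.length ≤ N)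
    (hM : ∀ X ∈ M, X.dd ≤ 3) (hP : ∀ X ∈ M, X.size ≤ P) (hQ : M.length + 1 ≤ Q)
    (hA₁ : A₁ ∈ M) (hA₂ : A₂ ∈ M) (hC : C.dd ≤ 3) (hCP : C.size ≤ P)
    (hvC : ∀ x ∈ C.vars, x ∈ V) (hv₁ : ∀ x ∈ A₁.vars, x ∈ V) (hv₂ : ∀ x ∈ A₂.vars, x ∈ V)
    (himp : ∀ τ : ℕ → Bool, A₁.eval τ = true → A₂.eval τ = true → C.eval τ = true)
    (hΦ : Φ.dd ≤ 6) (hΦB : 8 * Φ.size ≤ B) (hJ : BD D B ℓ (disjList [conjList M, Φ]))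
    (hD : 16 ≤ D) (hB : 128 * (Q * (P + 1) + 1) + 40 * N + 600 ≤ B) :
    BD D B (ℓ + stepLines P Q N) (disjList [conjList (C :: M), Φ]) := by
  have hstep := localStepS V hV hVN hM hP hQ hA₁ hA₂ hC hCP hvC hv₁ hv₂ himp hD hB
  refine (chainStepS hM hP hQ hC hCP hΦ hΦB hJ hstep hD hB (N := N)).mono ?_
  have : 1700 ≤ stepLines P Q N := by unfold stepLines; omega
  omega

/-- **End of the chain.** If `⊥ ∈ M` then the carried line `⊢ ⋀M, Φ` yields `Φ`: extract
`⊢ ¬⋀M, ⊥`, cut, cut `⊥` away against `⊢ ¬⊥`, and remove the trailing `⊥` of the sequent.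
[Shoenfield 1967, §3.1] [folklore] -/
theorem chainFinalS (hM : ∀ X ∈ M, X.dd ≤ 3) (hP : ∀ X ∈ M, X.size ≤ P) (hQ : M.length ≤ Q)
    (hbot : const false ∈ M) (hΦ : Φ.dd ≤ 6) (hΦB : 8 * Φ.size ≤ B)
    (hJ : BD D B ℓ (disjList [conjList M, Φ]))
    (hD : 16 ≤ D) (hB : 128 * (Q * (P + 1) + 1) + 600 ≤ B) :
    BD D B (ℓ + 126 * Q + 3000) Φ := by
  have hKsize : (conjList M).size ≤ Q * (P + 1) + 1 := size_conjList_le hP hQ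
  have hKdd : (conjList M).dd ≤ 5 := dd_conjList_le_five hM
  have hnKdd : (neg (conjList M)).dd ≤ 6 := dd_neg_conjList_le_six hM
  have hΦ1 := altDepthAux_le_dd_succ 1 Φ
  -- `⊢ ¬K, ⊥`
  have e : BD D B (12 + 126 * Q) (disjList [neg (conjList M), const false]) :=
    (conjExtractS hbot hM (by omega) (by omega)).mono (by nlinarith)
  have hctx : ∀ X ∈ [neg (conjList M), const false, Φ], X.dd ≤ 6 := by
    intro X hX
    simp only [List.mem_cons, List.not_mem_nil, or_false] at hX
    rcases hX with rfl | rfl | rfl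
    · exact hnKdd
    · simp
    · exact hΦ
  have e' : BD D B (12 + 126 * Q + 800) (disjList [neg (conjList M), const false, Φ]) :=
    subsetN (N := 3) e (by intro X hX; simp only [List.mem_cons, List.not_mem_nil, or_false] at hX ⊢; tauto)
      hctx (by omega) (by
        simp only [size_disjList_cons, size_disjList_nil, size]; omega) (by simp) (by simp)
  have J' : BD D B (ℓ + 800) (disjList [conjList M, const false, Φ]) :=
    subsetN (N := 3) hJ (by intro X hX; simp only [List.mem_cons, List.not_mem_nil, or_false] at hX ⊢; tauto)
      (p := 6) (by
        intro X hX; simp only [List.mem_cons, List.not_mem_nil, or_false] at hX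
        rcases hX with rfl | rfl | rfl
        · exact hKdd.trans (by norm_num)
        · simp
        · exact hΦ) (by omega) (by
        simp only [size_disjList_cons, size_disjList_nil, size]; omega) (by simp) (by simp)
  -- `⊢ ⊥, Φ`
  have c₁ := cutS J' e' (by simp only [size_disjList_cons, size_disjList_nil, size]; omega)
  -- `⊢ ¬⊥, Φ`
  have nb : BD D B 1 (neg (const false)) := negBotB (by omega) (by omega)
  have nb₁ : BD D B (1 + 3) (disjList [neg (const false)]) :=
    unitS nb (by omega) (by simp only [size]; omega)
  have nb₂ : BD D B (1 + 3 + 450) (disjList [neg (const false), Φ]) :=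
    subsetN (N := 2) nb₁ (by intro X hX; simp only [List.mem_cons, List.not_mem_nil, or_false] at hX ⊢; tauto)
      (p := 6) (by
        intro X hX; simp only [List.mem_cons, List.not_mem_nil, or_false] at hX
        rcases hX with rfl | rfl
        · simp
        · exact hΦ) (by omega) (by
        simp only [size_disjList_cons, size_disjList_nil, size]; omega) (by simp) (by simp)
  -- `⊢ Φ`, then `Φ`
  have c₂ := cutS c₁ nb₂ (by simp only [size_disjList_cons, size_disjList_nil]; omega)
  have c₂' : BD D B (ℓ + 800 + (12 + 126 * Q + 800) + 2 + (1 + 3 + 450) + 2)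
      (disj Φ (const false)) := c₂
  have fin := removeBotB c₂' (by rw [dd_neg]; omega) (by omega)
  have hle : ℓ + 800 + (12 + 126 * Q + 800) + 2 + (1 + 3 + 450) + 2 + 8 ≤ ℓ + 126 * Q + 3000 := by
    clear fin c₂' c₂ nb₂ nb₁ nb c₁ J' e' hctx e hΦ1 hnKdd hKdd hKsize hB hD hJ hΦB hΦ hbot hQ hP hM
    omega
  exact fin.mono hle

end TextbookFrege

end Literature.Computability.MetaComplexity
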